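import Summits.ResolutionOfSingularities.ResolutionOfSingularities.Theorems.FrobeniusClosingSteerShadowVacuous
import Summits.ResolutionOfSingularities.ResolutionOfSingularities.Theorems.FrobeniusClosingSteerNoHeightOneCarrierTwo
import Summits.ResolutionOfSingularities.ResolutionOfSingularities.Theorems.FrobeniusClosingSteerNoHeightOneCarrierTwoAlgebra
import Summits.ResolutionOfSingularities.ResolutionOfSingularities.Theorems.FrobeniusClosingSteerAutoPermissibleTwo
import Literature.AlgebraicGeometry.Resolution.RegularLocalHeights
import Literature.AlgebraicGeometry.Resolution.RegularLocalRingsQuotient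
import Literature.AlgebraicGeometry.Resolution.RsopMonomialIdeals
import HarnessLib

/-!
# Crux `Steer` (stmt-ResolutionOfSingularities-16345), chain W4.1 — E-ROW row 9 (R2) `PointStepNoSurfaceCleaningTwoN` PROVED

OURS (campaign `res-hironaka`, rung L ★L-G4, slot W4.1). The word (R2) COUPLING is res-L0-w41-idea-2 g13's, VERBATIM from
`L/res-L0-w41-idea-2/g13/Sketch-hev-rigidity-v1_2.lean` 0f27a225a87339b2 §3 (byte = words v1 edf5aa4fd9c44818 §3; tri-1 WORD-CHECK 19:09:59Z); kernel route =
idea-2's `g13/R2-PROOF-MAP.md` 5ec3e233486c0a6e; res-L0-w41-plan-1 RULINGS 258(d)/261(c)/263 («(R2) → res-D-pv-035»). Replaces the role of no printed item; NOT a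
statement of the manuscript under review [claim: Hironaka2017, status: under-review]; AI-produced, weaker than expert review; counted 0.

STATEMENT (R2). At a POINT step of a σ_top-steered rank-one run from a normal start (p = 2, n = 4), NO cleaning of the radicand lies in the square of the
ideal of an r.s.o.p. PAIR: `s i ^ 2 − g ^ 2 ∉ (σ, τ)²`.

KERNEL PROOF.
* (L1) `not_sub_sq_mem_span_pair_sq` — MEMBER-LOCAL LEGALITY ONE HEIGHT DOWN (cf. `BetaLegality.isPermissibleCentre_of_add_sq_mem_sq` for a curve): over a regular
  local member `R` of dimension `4`, if `⊥` and every height-one prime are NOT singular primes of `f` and the σ_top centre is the closed point, then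
  `f − g² ∉ (σ, τ)²` for an r.s.o.p. pair `σ, τ`: otherwise `Q = (σ, τ)` is a SINGULAR prime (`AutoPermissible.singular_atPrime_of_sub_pow_mem_sq`), prime with
  `R ⧸ Q` regular of dimension `2` and `ht Q = 2` (`IsRsopPart`, `height_add_ringKrullDim_quotient`), `Q ≠ 𝔪`, MINIMAL among singular primes and of MAXIMAL dimension
  (every singular prime has height `≥ 2`), i.e. `IsTopSingComponent`, hence `IsPermissibleCentre R 2 f Q` (the cleaner clause IS the absurd hypothesis) — contradicting
  the σ_top word at the closed point.
* (L2) `not_isSingPrime_of_height_one_of_isMaxGenAt` — NO SINGULAR HEIGHT-ONE PRIME AT A MAXIMAL GENERATOR: a singular height-one prime is `(u)` with `u` prime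
  (`NoHeightOneCarrier.exists_eq_span_singleton_of_height_eq_one`) and carries a witness `d²f − a² ∈ (u)²`, `d ∉ (u)` (`NoHeightOneCarrier.exists_witness_of_singular`);
  the local–global Frobenius congruence (N5) turns it into `f = g₀² + u²u₀` GLOBALLY, whence `s = g₀ + u·s″` with `s″² = u₀ ∈ R`, `s″ ∉ R` — a NON-UNIT FORM,
  so `s` is not a maximal generator (`MaxGenDictionary.not_isMaxGenAt_of_nonunit_form`, (M1 ⇐)).
* (L3) plumbing, exactly as in `MaxVacuity` (`…ShadowVacuous`, p557530): `runHygieneTwo_holds` (dim 4, `hirr`), `steeredMembersRegular_holds`,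
  `MaxVacuity.memberFrobeniusCongruence_two` (N5), `MaxVacuity.isMaxGenAt_of_isPointStep`, purity at `⊥` (`NoHeightOneCarrier.isRegularLocalRing_radicand_of_eq_bot`),
  and the σ_top word `IsSigmaTopCentre (R i) 2 ⟨s i², _⟩ (P i)` from `IsSteeredRun` with `P i = 𝔪` at a point step.
[cite: Matsumura1987, Thm. 14.2, Thm. 20.3] [folklore]
bears_on: LADDER-RESOLUTION L ★L-G4 W4.1 (crux `Steer`, (MAX-ND)ᴵ rigidity, E-ROW row 9 (R2)).
-/

noncomputable section

set_option linter.dupNamespace false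
set_option autoImplicit false

open IsLocalRing Polynomial
open Literature.AlgebraicGeometry.Resolution
open Summit.ResolutionOfSingularities.ResolutionOfSingularities.Theorems.SwitchingDichotomy.Words
open Summit.ResolutionOfSingularities.ResolutionOfSingularities.Theorems.SteerRankThinness (Concl HasProperCoarsening)
open Summit.ResolutionOfSingularities.ResolutionOfSingularities.Theorems.SwitchingDichotomy.ArithReduction
open Summit.ResolutionOfSingularities.ResolutionOfSingularities.Theorems.SwitchingDichotomy

namespace Summit.ResolutionOfSingularities.ResolutionOfSingularities.Theorems.SwitchingDichotomy.HevLeaf.PointStepNoSurfaceCleaning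

variable {K : Type} [Field K]

/-! ## §3 (R2) COUPLING — the word, VERBATIM (idea-2 v1.2 §3) -/

/-- **(R2) `PointStepNoSurfaceCleaningTwoN`** — COUPLING: at a POINT step of a σ_top-steered rank-one run from a normal start (p = 2, n = 4), NO cleaning
of the radicand lies in the square of the ideal of an rsop PAIR: `s i ^ 2 − g ^ 2 ∉ (σ, τ)²`. PROOF BY HAND (memo §3): otherwise `Q = (σ, τ)` is a
singular prime (`AutoPermissible.singular_atPrime_of_sub_pow_mem_sq`) with `R i ⧸ Q` regular of dimension 2; the generator at a point step is maximal
(`MaxVacuity.isMaxGenAt_of_isPointStep`), so by (M1)+(N5) no height-one prime is singular and `Q` is MINIMAL among singular primes, of the largest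
dimension a singular prime can have (height ≥ 2); hence `IsTopSingComponent`, hence `IsPermissibleCentre R 2 f Q` (`Q ≠ 𝔪ᵢ` as `n = 4`), contradicting
the σ_top word `IsSigmaTopCentre … (maximalIdeal _)` read off `IsSteeredRun` at a point step. CONSEQUENCE for even tails: the cleaned radicand always
carries a term of `(σ,τ)`-degree ≤ 1 («light coupling term»), necessarily of order ≥ 2e + 1. Kernel size M. Why it might fail: only a typing slip (the
dimension bookkeeping `height Q = 2 ⇒ dim R⧸Q = 2` is `height_add_ringKrullDim_quotient`). OURS — candidate word invented by res-L0-w41-idea-2 g13, not a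
statement of the manuscript under review; provenance in prose only (parameterless Prop). Kernel proof: `pointStepNoSurfaceCleaningTwoN_holds` below. (folklore) -/
def PointStepNoSurfaceCleaningTwoN : Prop :=
  ∀ p : ℕ, p = 2 →
    ∀ (k K : Type) [Field k] [CharP k p] [PerfectField k] [Field K] [Algebra k K]
    (O : ValuationSubring K) (A₀ : Subalgebra k K) (h₀ : A₀.toSubring ≤ O.toSubring) (t : K),
    CoreDatum p 4 k K O A₀ h₀ t → ¬ HasProperCoarsening O →
    ∀ (R : ℕ → Subring K) (P : (i : ℕ) → Ideal (R i)) (s : ℕ → K),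
      R 0 = locAtCentre A₀.toSubring O → NormalAt O (R 0) p t → IsSteeredRun O R P t p s →
      ∀ i : ℕ, IsPointStep R P i →
        ∀ (_ : IsLocalRing (R i)) (hs : s i ^ p ∈ R i) (g σ τ : R i), IsRsopPart ![σ, τ] →
          (⟨s i ^ p, hs⟩ : R i) - g ^ p ∉ Ideal.span {σ, τ} ^ 2

/-! ## (L1) member-local legality, one height down -/

/-- `range ![σ, τ] = {σ, τ}`. [folklore] -/
theorem range_vec2 {α : Type} (σ τ : α) : Set.range ![σ, τ] = {σ, τ} := by
  rw [Matrix.range_cons, Matrix.range_cons_empty, Set.singleton_union]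

/-- **(L1)** Over a regular local member `R ⊆ K` (`char K = 2`) of dimension `4`: if neither `⊥` nor any height-one prime is a singular prime of the radicand
`f`, and the σ_top centre at `(R, f)` is the closed point, then `f − g² ∉ (σ, τ)²` for every r.s.o.p. pair `σ, τ` and every `g` — otherwise `(σ, τ)` would be
a σ_top-PERMISSIBLE surface centre. OURS. [cite: Matsumura1987, Thm. 14.2] -/
theorem not_sub_sq_mem_span_pair_sq [CharP K 2] (R : Subring K) [IsRegularLocalRing R] (hdim : ringKrullDim R = 4) (f : R)
    (hbot : ¬ IsSingPrime R 2 f ⊥)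
    (hh1 : ∀ (Q : Ideal R) [Q.IsPrime], Q.height = 1 → ¬ IsSingPrime R 2 f Q)
    (hσ : IsSigmaTopCentre R 2 f (maximalIdeal R))
    (σ τ g : R) (hst : IsRsopPart ![σ, τ]) : f - g ^ 2 ∉ Ideal.span {σ, τ} ^ 2 := by
  classical
  intro hmem
  haveI : Fact (Nat.Prime 2) := ⟨Nat.prime_two⟩
  set Q : Ideal R := Ideal.span {σ, τ} with hQdef
  have hQr : Ideal.span (Set.range ![σ, τ]) = Q := by rw [range_vec2]
  -- `Q` is prime with regular quotient of dimension `2`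
  haveI hQ : Q.IsPrime := hQr ▸ hst.isPrime_span_range
  have hregQ : IsRegularLocalRing (R ⧸ Q) := hQr ▸ hst.isRegularLocalRing_quotient
  haveI : Nontrivial (R ⧸ Q) := Ideal.Quotient.nontrivial_iff.mpr hQ.ne_top
  haveI : IsLocalRing (R ⧸ Q) := .of_surjective' _ Ideal.Quotient.mk_surjective
  obtain ⟨c, hc⟩ := exists_nat_cast_eq_ringKrullDim (R := R)
  have hc4 : c = 4 := by
    have h : (c : WithBot ℕ∞) = ((4 : ℕ) : WithBot ℕ∞) := by rw [← hc, hdim]; norm_cast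
    exact_mod_cast h
  obtain ⟨nQ, hnQ⟩ := exists_nat_cast_eq_ringKrullDim (R := R ⧸ Q)
  have hnQ2 : nQ = 2 := by
    have h := hst.ringKrullDim_quotient_add
    rw [hQr, hnQ, hc] at h
    have h' : ((nQ + 2 : ℕ) : WithBot ℕ∞) = (c : WithBot ℕ∞) := by push_cast; exact h
    have : nQ + 2 = c := by exact_mod_cast h'
    omega
  -- height of `Q` is `2`
  obtain ⟨mQ, hmQ⟩ := ENat.ne_top_iff_exists.mp (Q.height_ne_top hQ.ne_top)
  have hmQ2 : mQ = 2 := by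
    have e := height_add_ringKrullDim_quotient (S := R) Q
    rw [← hmQ, hnQ, hc] at e
    have : mQ + nQ = c := by exact_mod_cast e
    omega
  have hQht : Q.height = 2 := by rw [← hmQ, hmQ2]; rfl
  -- `Q ≠ 𝔪`
  have hne : Q ≠ maximalIdeal R := by
    intro heq
    have h0 : ringKrullDim (R ⧸ Q) = 0 := by
      rw [heq]
      letI : Field (R ⧸ maximalIdeal R) := Ideal.Quotient.field (maximalIdeal R)
      exact ringKrullDim_eq_zero_of_isField (Field.toIsField _)
    rw [h0] at hnQ
    have : (0 : ℕ) = nQ := by exact_mod_cast hnQ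
    omega
  -- `Q` is singular
  have hsing : IsSingPrime R 2 f Q := AutoPermissible.singular_atPrime_of_sub_pow_mem_sq K 2 R f Q hmem
  -- every singular prime has height `≥ 2`
  have hge : ∀ (Q' : Ideal R) [Q'.IsPrime], IsSingPrime R 2 f Q' → 2 ≤ Q'.height := by
    intro Q' _ hQ'
    have hne0 : Q' ≠ ⊥ := by rintro rfl; exact hbot hQ'
    have h1 : 1 ≤ Q'.height := Order.one_le_iff_ne_zero.mpr fun h0 => hne0 (Ideal.height_eq_zero_iff_eq_bot.mp h0)
    obtain ⟨m, hm⟩ := ENat.ne_top_iff_exists.mp (Q'.height_ne_top (Ideal.IsPrime.ne_top ‹_›))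
    rw [← hm] at h1 ⊢
    have h1' : 1 ≤ m := by exact_mod_cast h1
    have hm1 : m ≠ 1 := fun h => hh1 Q' (by rw [← hm, h]; rfl) hQ'
    have : 2 ≤ m := by omega
    exact_mod_cast this
  -- `IsTopSingComponent`
  have htop : IsTopSingComponent R 2 f Q := by
    refine ⟨hQ, hsing, fun Q' _ hQ' hle => ?_, fun Q' _ hQ' _ => ?_⟩
    · by_contra hneq
      have hlt : Q'.height < Q.height := Ideal.height_strict_mono_of_isPrime (lt_of_le_of_ne hle hneq)
      rw [hQht] at hlt
      exact absurd (lt_of_le_of_lt (hge Q' hQ') hlt) (lt_irrefl _)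
    · -- maximal dimension among singular primes: `dim R/Q' = 4 − ht Q' ≤ 2 = dim R/Q`
      haveI : Nontrivial (R ⧸ Q') := Ideal.Quotient.nontrivial_iff.mpr (Ideal.IsPrime.ne_top ‹_›)
      haveI : IsLocalRing (R ⧸ Q') := .of_surjective' _ Ideal.Quotient.mk_surjective
      obtain ⟨n', hn'⟩ := exists_nat_cast_eq_ringKrullDim (R := R ⧸ Q')
      obtain ⟨m', hm'⟩ := ENat.ne_top_iff_exists.mp (Q'.height_ne_top (Ideal.IsPrime.ne_top ‹_›))
      have h2 := hge Q' hQ'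
      have eQ' := height_add_ringKrullDim_quotient (S := R) Q'
      rw [← hm', hn', hc] at eQ'
      rw [← hm'] at h2
      have e2 : m' + n' = c := by exact_mod_cast eQ'
      have e3 : 2 ≤ m' := by exact_mod_cast h2
      rw [hn', hnQ, hnQ2]
      have : n' ≤ 2 := by omega
      exact_mod_cast this
  -- hence a permissible centre, contradicting σ_top at the closed point
  have hperm : IsPermissibleCentre R 2 f Q := ⟨hne, htop, hregQ, ⟨g, hmem⟩⟩
  rcases hσ with hP | ⟨-, hno, -⟩
  · exact hP.1 rfl
  · exact hno _ hperm

/-! ## (L2) no singular height-one prime at a maximal generator -/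

/-- **(L2)** Over a regular local member `R ⊆ K` (`char K = 2`), let `s` with `s² ∈ R`, `s ∉ Frac`-rational over `R` in the run's sense (`hirr`), satisfy the
local–global Frobenius congruence (N5) and be a MAXIMAL generator. Then no height-one prime of `R` is a singular prime of `s²`: such a prime is `(u)`, `u` prime,
with a witness `d²s² − a² ∈ (u)²`, `d ∉ (u)`; (N5) gives `s² = g₀² + u²u₀`, so `s = g₀ + u·s″` with `s″² = u₀`, `s″ ∉ R` — a non-unit form, contradicting
maximality by `MaxGenDictionary.not_isMaxGenAt_of_nonunit_form`. OURS. [cite: Matsumura1987, Thm. 20.3] -/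
theorem not_isSingPrime_of_height_one_of_isMaxGenAt [CharP K 2] (R : Subring K) [IsRegularLocalRing R] (t s : K) (hs : s ^ 2 ∈ R)
    (hirr : ∀ y z : R, (z : K) ≠ 0 → s * z ≠ y)
    (hN5 : ∀ (π a b c : R), Prime π → ¬ π ∣ b → b ^ 2 * ⟨s ^ 2, hs⟩ = a ^ 2 + π ^ 2 * c →
      ∃ g₀ u₀ : R, (⟨s ^ 2, hs⟩ : R) = g₀ ^ 2 + π ^ 2 * u₀)
    (hmax : IsMaxGenAt R 2 t s) (Q : Ideal R) [Q.IsPrime] (hQ : Q.height = 1) : ¬ IsSingPrime R 2 ⟨s ^ 2, hs⟩ Q := by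
  classical
  intro hsing
  obtain ⟨u, hQu, hu⟩ := NoHeightOneCarrier.exists_eq_span_singleton_of_height_eq_one (R := R) Q hQ
  obtain ⟨a, d, hdQ, hw⟩ := NoHeightOneCarrier.exists_witness_of_singular (R := R) ⟨s ^ 2, hs⟩ Q hsing
  -- `d²s² − a² = u²c`
  rw [hQu, Ideal.span_singleton_pow, Ideal.mem_span_singleton] at hw
  obtain ⟨c, hc⟩ := hw
  have hud : ¬ u ∣ d := by
    intro h
    exact hdQ (hQu ▸ Ideal.mem_span_singleton.mpr h)
  have heq : d ^ 2 * ⟨s ^ 2, hs⟩ = a ^ 2 + u ^ 2 * c := by rw [← hc]; ring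
  obtain ⟨g₀, u₀, hf⟩ := hN5 u a d c hu hud heq
  -- the non-unit form `s = g₀ + u·s″`, `s″ = (s − g₀)/u`
  have hu0 : (u : K) ≠ 0 := by
    intro h
    exact hu.ne_zero (Subtype.ext h)
  set s'' : K := (s - g₀) / u with hs''
  have hform : s = (g₀ : K) + (u : K) * s'' := by
    rw [hs'']; field_simp; ring
  have h2K : (2 : K) = 0 := CharTwo.two_eq_zero
  have hsq : s'' ^ 2 = (u₀ : K) := by
    have hfK : (s ^ 2 : K) = (g₀ : K) ^ 2 + (u : K) ^ 2 * (u₀ : K) := by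
      have := congrArg (fun r : R => (r : K)) hf
      simpa using this
    have hus : (u : K) * s'' = s - g₀ := by rw [hs'']; field_simp
    have h1 : ((u : K) * s'') ^ 2 = (u : K) ^ 2 * (u₀ : K) := by
      rw [hus]
      linear_combination hfK + ((g₀ : K) * ((g₀ : K) - s)) * h2K
    rw [mul_pow] at h1
    exact mul_left_cancel₀ (pow_ne_zero 2 hu0) h1
  have h2 : s'' ^ 2 ∈ R := by rw [hsq]; exact u₀.2
  have hS : s'' ∉ R := by
    intro hmem
    -- then `s ∈ R`: `s * 1 = g₀ + u s″`
    have hsR : s ∈ R := by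
      rw [hform]
      exact R.add_mem g₀.2 (R.mul_mem u.2 hmem)
    exact hirr ⟨s, hsR⟩ 1 (by simp) (by simp)
  have hum : u ∈ maximalIdeal R := (IsLocalRing.mem_maximalIdeal u).mpr hu.not_unit
  exact MaxGenDictionary.not_isMaxGenAt_of_nonunit_form R h2 hS hum hform hmax

/-! ## (L3) the run-level discharge -/

/-- **(R2) `PointStepNoSurfaceCleaningTwoN` HOLDS.** OURS. [folklore] -/
theorem pointStepNoSurfaceCleaningTwoN_holds : PointStepNoSurfaceCleaningTwoN := by
  intro p hp2 k K _ _ _ _ _ O A₀ h₀ t core hrk R P s hR0 hN hrun i hPi hloc hs g σ τ hst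
  subst hp2
  classical
  haveI : Fact (Nat.Prime 2) := ⟨Nat.prime_two⟩
  haveI : CharP K 2 := charP_of_injective_algebraMap (algebraMap k K).injective 2
  obtain ⟨-, -, hdim, -, hirr, -⟩ := runHygieneTwo_holds 2 rfl k K O A₀ h₀ t core hrk R P s hR0 hrun
  haveI hreg : IsRegularLocalRing (R i) :=
    steeredMembersRegular_holds 2 Nat.prime_two 4 le_rfl k K O A₀ h₀ t core R P s i hR0
      ⟨hrun.1, fun j _ => by obtain ⟨_, hs, -⟩ := hrun.2 j; exact hs, fun j _ => hrun.2 j⟩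
  -- the σ_top word at the point step: `P i = 𝔪`
  obtain ⟨hloc', hs', hσ, -, -⟩ := hrun.2 i
  obtain ⟨hloc'', hPm⟩ := hPi
  rw [hPm] at hσ
  -- maximality of the generator, (N5), purity at `⊥`
  have hmax : IsMaxGenAt (R i) 2 t (s i) := MaxVacuity.isMaxGenAt_of_isPointStep k K O A₀ h₀ t core hrk R P s hR0 hN hrun i ⟨hloc, hPm⟩
  have hN5 : ∀ (π a b c : R i), Prime π → ¬ π ∣ b → b ^ 2 * ⟨s i ^ 2, hs⟩ = a ^ 2 + π ^ 2 * c →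
      ∃ g₀ u₀ : R i, (⟨s i ^ 2, hs⟩ : R i) = g₀ ^ 2 + π ^ 2 * u₀ :=
    fun π a b c hπ hπb heq => MaxVacuity.memberFrobeniusCongruence_two k K O A₀ h₀ t core R P s hR0 hrun i hs π a b c hπ hπb heq
  have hbot : ¬ IsSingPrime (R i) 2 ⟨s i ^ 2, hs⟩ ⊥ := fun h =>
    h (NoHeightOneCarrier.isRegularLocalRing_radicand_of_eq_bot (R i) (s i) hs (hirr i) ⊥ rfl)
  have hh1 : ∀ (Q : Ideal (R i)) [Q.IsPrime], Q.height = 1 → ¬ IsSingPrime (R i) 2 ⟨s i ^ 2, hs⟩ Q :=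
    fun Q _ hQ => not_isSingPrime_of_height_one_of_isMaxGenAt (R i) t (s i) hs (hirr i) hN5 hmax Q hQ
  exact not_sub_sq_mem_span_pair_sq (R i) (hdim i) ⟨s i ^ 2, hs⟩ hbot hh1 hσ σ τ g hst

end Summit.ResolutionOfSingularities.ResolutionOfSingularities.Theorems.SwitchingDichotomy.HevLeaf.PointStepNoSurfaceCleaning

end
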